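import Mathlib.RingTheory.AdicCompletion.LocalRing
import Mathlib.RingTheory.AdicCompletion.AsTensorProduct
import Mathlib.RingTheory.AdicCompletion.Noetherian
import Mathlib.RingTheory.Flat.FaithfullyFlat.Algebra
import HarnessLib

/-!
# Stub `stub_completionLift` for crux stmt-ResolutionOfSingularities-15917
(`RadicialJung.CleanModels`)

For a Noetherian local ring `O` with maximal ideal `𝔪` and `𝔪`-adic completion
`Ô = AdicCompletion 𝔪 O`, the structure map `O → Ô` is

1. injective — Krull's intersection theorem `⋂ 𝔪ⁿ = 0` (`IsHausdorff 𝔪 O`, Mathlib instance for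
   local Noetherian rings) and `AdicCompletion.of_injective`;
2. local — Mathlib instance `IsLocalHom (algebraMap O Ô)` (`AdicCompletion/LocalRing.lean`:
   `maximalIdeal Ô = 𝔪.map (algebraMap O Ô)`);
3. surjective on spectra — `Ô` is flat over the Noetherian `O` (`AdicCompletion.flat_of_isNoetherian`),
   both rings are local and the map is local, hence `Ô` is faithfully flat
   (`Module.FaithfullyFlat.of_flat_of_isLocalHom`) and every prime of `O` is the contraction of a
   prime of `Ô` (`PrimeSpectrum.comap_surjective_of_faithfullyFlat`).
-/

noncomputable section

set_option linter.dupNamespace false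

open IsLocalRing

namespace Summit.ResolutionOfSingularities.ResolutionOfSingularities.Theorems.RadicialJung.CleanModels

universe u

/-- **The completion map of a Noetherian local ring.** For a Noetherian local ring `O` with
`𝔪`-adic completion `Ô = AdicCompletion (maximalIdeal O) O`, the map `O → Ô` is injective
(Krull's intersection theorem), local (`𝔪̂ ∩ O = 𝔪`), and every prime `q` of `O` lies under some
prime `Q` of `Ô` (`Ô` is faithfully flat over `O`). -/
theorem stub_completionLift {O : Type u} [CommRing O] [IsLocalRing O] [IsNoetherianRing O] :
    Function.Injective (algebraMap O (AdicCompletion (maximalIdeal O) O)) ∧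
      IsLocalHom (algebraMap O (AdicCompletion (maximalIdeal O) O)) ∧
      ∀ q : Ideal O, q.IsPrime → ∃ Q : Ideal (AdicCompletion (maximalIdeal O) O), Q.IsPrime ∧
        Q.comap (algebraMap O (AdicCompletion (maximalIdeal O) O)) = q := by
  refine ⟨AdicCompletion.of_injective (maximalIdeal O) O, inferInstance, fun q hq => ?_⟩
  haveI : Module.FaithfullyFlat O (AdicCompletion (maximalIdeal O) O) :=
    Module.FaithfullyFlat.of_flat_of_isLocalHom
  obtain ⟨⟨Q, hQ⟩, hQq⟩ :=
    PrimeSpectrum.comap_surjective_of_faithfullyFlat (A := O)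
      (B := AdicCompletion (maximalIdeal O) O) ⟨q, hq⟩
  exact ⟨Q, hQ, by simpa using congrArg PrimeSpectrum.asIdeal hQq⟩

end Summit.ResolutionOfSingularities.ResolutionOfSingularities.Theorems.RadicialJung.CleanModels

end
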